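import Mathlib
import HarnessLib
import HarnessLib.Audit
import Summits.AtomisticToContinuum.Statement
import Literature.MathematicalPhysics.StatisticalMechanics.BarlowStacking

/-!
Route: FlatTorusDefectGap

CLOSED (retired) 2026-08-15T13:42:32Z by operator:999:1257524 — reason: not-a-thesis: assembly does not conclude the sub-problem Statement — note: D-0027 §2.1 audit (human 2026-08-15: routes that do not decide the summit are removed): the assembly concludes `Literature.MathematicalPhysics.StatisticalMechanics.Crystallization`, not the sub-problem statement; a NEW conforming route may be opened from the same idea (generated `closes : … → _root_. The file is kept as the record of this route; refuted decls are indexed as negative knowledge (`ledger negatives`).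

# Route FlatTorusDefectGap — Flat tori suffice: one uniform defect-gap inequality over all periodic
competitors gives both conjuncts

It suffices to show the UNIFORM TORUS DEFECT GAP X (card flat-tori-suffice, its CRUX-T read in the
universal
cover): there is a periodic configuration P₀ of ℝ³ such that for every window radius R and tolerance
ε there is
g > 0 with, for EVERY periodic configuration P — i.e. every finite point set on every flat 3-torus
ℝ³/Λ (motif =
the point set, per-cell energy = #motif·e(P)) — g·#{motif points of P whose R-environment in
P.points is not
ε-matched, after a linear isometry, to the R-environment of some site of P₀} ≤ #motif·(e(P) −
e(P₀)).
X = DefectGapAtMinimiser ∧ CrysPeriodicMinAttained (ranks 2 and 4). X ⇒ conjunct (i) by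
padding-periodisation
(cross terms of V_LJ beyond distance 1 are ≤ 0) and trial blocks; X ⇒ conjunct (ii) because the same
padding turns
every N-particle ground state into a torus point set with ≤ (E(N) − N e(P₀))/g = o(N) bad particles,
and one good
particle per scale plus compactness of O(3) gives the Blanc–Lewin window (shared bookkeeping item
WindowsCrystallize of route
OneGrainWindow). No cluster geometry, no surfaces, no measures. X is the TORUS form of
OneGrainWindow's cluster coercivity
LjDefectCoercivity (stmt-3505): X ⇒ 3505 by padding (bridge item TorusGapGivesCoercivity), 3505 ⇒ X
by block limits; the two routes
are alternative decompositions of one statement (D-0019) and share 0627, 0629, 3507.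
Lean: `∃ P₀ : Literature.MathematicalPhysics.StatisticalMechanics.PeriodicConfiguration 3, ∀ R ε :
ℝ, 0 < R → 0 < ε → ∃ g : ℝ, 0 < g ∧ ∀ P :
Literature.MathematicalPhysics.StatisticalMechanics.PeriodicConfiguration 3, g * ({x :
EuclideanSpace ℝ (Fin 3) | x ∈ P.motif ∧ ¬ (∃ p₀ ∈ P₀.motif, ∃ A : EuclideanSpace ℝ (Fin 3) ≃ₗᵢ[ℝ]
EuclideanSpace ℝ (Fin 3), (∀ p ∈ P₀.points, dist p p₀ ≤ R → ∃ y ∈ P.points, dist y (x + A (p - p₀))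
≤ ε) ∧ (∀ y ∈ P.points, dist y x ≤ R → ∃ p ∈ P₀.points, dist y (x + A (p - p₀)) ≤ ε))}.ncard : ℝ) ≤
(P.motif.card : ℝ) * (P.energyPerParticle
Literature.MathematicalPhysics.StatisticalMechanics.lennardJones - P₀.energyPerParticle
Literature.MathematicalPhysics.StatisticalMechanics.lennardJones)`

## Assembly
Pure logic plus ONE proved in-tree fact, checked in the planner's Sketch.lean (theorem
Assembly_provable, sorry-free): ranks 2 and 4 give
the Target with P₀ := the minimiser; GapGivesEnergy turns Target + periodisation + upper bound into
conjunct (i); GapGivesWindows gives the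
eventual matched windows, and WindowsCrystallize (3507) with the separation supplied by
LennardJonesMinimalDistance_holds gives conjunct
(ii); Crystallization is the conjunction. Ranks 3 and 5 are rungs of rank 2 (3 is implied by 2,
proved in the sketch; 5 is its Barlow
special case up to relaxation) and enter only through the two-layer plan; TorusGapGivesCoercivity is
the bridge to OneGrainWindow.

Rationale: WHY THIS LINE. Every other route localises the ENERGY (a pointwise e_loc ≥ e* with boundary terms on
clusters, CrystalLocalRigidity (a); contact-graph
rigidity, CrystalKissingRigidity K1/K2); this line instead moves the whole problem onto closed flat
manifolds, where transfer/gauge terms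
telescope to zero identically, and asks for ONE averaged inequality with a defect-count gap, from
which both conjuncts follow by soft,
already-typed glue resting only on PROVED cone facts (LennardJonesMinimalDistance_holds,
BlancLewin2015_8_holds,
PeriodicConfiguration.tendsto_sum_of_eventually_near', isometryImage/translate,
summable_lennardJones_dist_three). The two signs doing
the work are V_LJ ≤ 0 beyond r = 1 (padding is free: the T = 0 case of temperedness, Ruelle1969
§3.3–3.4; BlancLewin2015 arXiv:1504.01153 §1.3
(8)–(9); item 0715) and "no boundary on a torus". Imported areas: the periodic-orbit /
ergodic-optimisation viewpoint (Radin1987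
doi:10.1142/s0217979287001675: periodic measures are dense, so nothing is lost on tori), Delone
local theory for the foreseen split
(DeloneDolbilinShtogrinGaliulin1976; DolbilinLagariasSenechal1998 = doi:10.1007/pl00009397; the
tree's HalesDSP_layerPackings_holds), certified
lattice sums for the stacking rung (PartayOrtnerCsanyi2017 arXiv:1705.01751). Versus print:
CoulangeonSchurmann2011 / CoulangeonSchurmann2021 (doi:10.1093/imrn/rnr048,
arXiv:1802.02072) study LOCAL optimality among m-periodic sets at fixed density for Gaussian-core
potentials — energy only; here the
inequality is global, density-free and carries the defect count. In-hub (routes opened today, read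
before filing): OneGrainWindow's
crux 3505 is the CLUSTER form of X (equivalent modulo padding/blocks; this route files the bridge
and shares its window bookkeeping 3507
instead of duplicating it) — what this route adds is the decomposition: the gap asked of EVERY
periodic minimiser (rank 2) separately
from attainment (rank 4, shared 0627), the boundary-free two-shell certificate form on tori (rank 3,
the statement LP/transfer searches
can certify cell by cell), and a typed gapped-stacking rung for the true couplings (rank 5);
FrustrationRangeLP's PeriodicCoordinationGap
(3424) is the coarse (coordination-defect, e* = inf) tier of the foreseen split of rank 3. Matching
is centred at motif SITES p₀ (the
vertex-transitivity repair of 0751, same convention as 3505). Negatives index: empty at filing.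

RANKED CRUXES. #0 TorusDefectGap (target) — X above: ∃ P₀ ∀ R ε ∃ g > 0 ∀ periodic P,
g·#bad_(R,ε)(P; P₀) ≤ #motif·(e(P) − e(P₀)), where x ∈ P.motif is good iff ∃ motif site p₀ of P₀, ∃
linear isometry A (as ≃ₗᵢ) with every p ∈ P₀.points ∩ B̄(p₀,R) having a point of P within ε of x +
A(p − p₀) and every y ∈ P.points ∩ B̄(x,R) lying within ε of some x + A(p − p₀), p ∈ P₀.points (the
matching clauses of 3505/3507 verbatim, with P.points for the particles). Equivalent to ranks 2 ∧ 4
(sketch: X ⇒ 4 and 2 ∧ 4 ⇒ X proved); equivalent to OneGrainWindow's 3505 modulo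
PeriodisationWithWindows (⇒, bridge item) and block limits (⇐, not filed). (why it might fail: exact
degeneracy of the periodic minimiser (two non-isometric minimisers ⇒ no single P₀ works; fallback:
finite-list variant) or a gapless family of periodic competitors (defect cost per visible defect →
0, e.g. vanishing stacking-fault energy).) [BlancLewin2015, arXiv:1504.01153,
CoulangeonSchurmann2011, CoulangeonSchurmann2021, Ruelle1969]
#2 DefectGapAtMinimiser (crux) — GAP AT EVERY MINIMISER (card item T1 in its strongest clean form):
every periodic configuration P₀ attaining the minimum of the Lennard-Jones energy per particle
satisfies the all-scales uniform defect-gap inequality of the Target (∀ R ε ∃ g ∀ periodic P).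
Content: uniqueness of the periodic minimiser up to isometry/local indistinguishability, and strict
positivity, uniformly over ALL periodic competitors of any density and cell size, of the formation
energy at chemical potential e(P₀) per (R,ε)-visible defect — vacancies/interstitials O(1), elastic
strain ~ε²/R², stacking faults ~|J₂|h/R, grain boundaries, cluster surfaces (via padding). The
hardest and most informative item; a finite-range certificate proves it through rank 3 + local rules
(two-layer plan). [difficulty: open-problem] (why it might fail: needs a UNIQUE periodic minimiser
with no gapless defects: dies if e(hcp)=e(some polytype) exactly, if the stacking-fault energy
vanishes (Hägg domination |J₂|>Σk|J_k| false; J₂≈−7e−5 uncertified), or if some defect family has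
cost per visible defect → 0.) [BlancLewin2015, PartayOrtnerCsanyi2017, FlatleyTheil2015, Theil2006,
CoulangeonSchurmann2021, Stillinger2001]
#3 TwoShellDefectGap (crux) — TWO-SHELL CERTIFICATE FORM (the card's CRUX-T with its range fixed,
not existential — with '∃ R' a tiny R would make the item a restatement of attainment): for every
periodic minimiser P₀ and every ε there is g > 0 with g·#bad_(2,ε)(P; P₀) ≤ #motif·(e(P) − e(P₀))
for all periodic P. R = 2 sees the shells at a·(1, √2, √(8/3), √3, √(11/3), 2), a ≈ 0.97, so h- and
c-type sites are already distinguished (ShortRangeStackingBlindness: fcc/hcp differ first at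
√(8/3)a). Implied by rank 2 (proved in the sketch); conversely rank 2 ⇐ this + robust local rules
for P₀ + counting (two-layer plan). This is what a finite-range transfer certificate / LP gauge
proves by summing local deficits over the torus, where transfers cancel exactly. [difficulty:
open-problem] (why it might fail: as rank 2, plus R=2 may be too short for any certificate: regular
tetrahedra/icosahedral shells beat close packing locally (TetrahedralFrustration,
IcosahedralClusters), so per-site deficits must be averaged; the stacking part of g(ε) is only
~|J₂|≈1e−4.) [Hales2012, HeitmannRadin1980, Theil2006, FlatleyTheil2015,
Literature.Barriers.AtomisticToContinuum.TetrahedralFrustration,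
Literature.Barriers.AtomisticToContinuum.ShortRangeStackingBlindness]
#4 CrysPeriodicMinAttained (crux) — the infimum over periodic configurations of ℝ³ (any full-rank
lattice, any finite motif) of the Lennard-Jones energy per particle is attained — shared item
stmt-AtomisticToContinuum-0627 (same signature); in this route it supplies the reference
configuration P₀ (Target ⇔ rank 2 ∧ this) and is the first place an aperiodic optimal stacking would
bite. [difficulty: XL] (why it might fail: no periodic configuration attains inf e if optimal LJ
stackings are aperiodic with unattained infimum (route RefuteCrystalPeriodicMin), i.e. if Hägg
domination fails at the 1e−4 margin; print treats Bravais lattices only (HCP is not Bravais).)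
[BlancLewin2015, arXiv:2107.14020, PartayOrtnerCsanyi2017,
Literature.Barriers.AtomisticToContinuum.HcpNotBravais,
Literature.Barriers.AtomisticToContinuum.Hubbard1978_mostHomogeneous]
#5 StackingDefectGap (crux) — GAPPED STACKING SELECTION FOR THE TRUE LJ COUPLINGS (the Barlow rung
of rank 2, typed over barlowPeriodicConfiguration): there is g > 0 such that for every in-layer
spacing a ∈ [24/25, 49/50] (a window around the LJ-optimal a* ≈ 0.971), ideal layer spacing h =
a√(2/3), every period p and p-periodic Hägg sequence s: p·(e(stacking of s) − e(hcp stacking, same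
a, h)) ≥ g·#{m < p : s(m+1) = s(m)} (cubic-type layer pairs per period; 0 for hcp, p for fcc). = the
Peierls count of 0737 made strict + a certified domination J₂(a,h) + Σ_(k≥3)(k−1)|J_k(a,h)| ≤ −g on
the window (interval arithmetic, r⁻⁶ tail bounds) + the layer regrouping of energyPerParticle
(BarlowStackingEnergy: barlowSiteEnergy_average_eq_haggEnergy, regrouping 'not proved there'). First
certifiable evidence for the gap; its failure kills ranks 2–3 as stated. [difficulty: L] (why it
might fail: Hägg domination for the actual LJ layer couplings may fail or hold without margin on
[0.96,0.98] (J₂≈−7.3e−5 and the ratio ≈250 are uncertified route-internal numerics); ideal c/a and a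
common a exclude relaxation, where polytypes compete (Pártay et al.).) [PartayOrtnerCsanyi2017,
Stillinger2001, BlancLewin2015,
Literature.Barriers.AtomisticToContinuum.ShortRangeStackingBlindness,
Literature.Barriers.AtomisticToContinuum.KissingTwelveDegeneracy]
#9 PeriodisationWithWindows (support) — PADDING-PERIODISATION WITH WINDOWS (transfer (P) of the
card; pointwise form of 0715): every injective N-point configuration x (N ≥ 1) and radius R admit a
periodic configuration P with motif = range x, N·e(P) ≤ 𝓔_N(x), and P.points ∩ B̄(x_i, R) ⊆ range x
for all i. Proof: lattice L·ℤ³ (ZSpan of a scaled basis), L > diam x + R + 1; copies are ≥ 1 apart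
where V_LJ ≤ 0 (lennardJones_nonpos); the lattice sums are absolutely summable
(summable_lennardJones_dist_three), so N·e(P) = 𝓔_N(x) + (cross terms ≤ 0). [difficulty:
provable-now] [BlancLewin2015, Ruelle1969]
#9 CrysEnergyUpper (support) — limsup E(N)/N ≤ ⨅ over periodic configurations of e (finite blocks of
any periodic configuration as trial states, boundary O(N^(2/3)), r⁻⁶ tail) — shared item
stmt-AtomisticToContinuum-0629 (same signature); with the Target's P₀ it yields E(N)/N → e(P₀).
[difficulty: M] [BlancLewin2015]
#9 GapGivesEnergy (support) — Target → PeriodisationWithWindows → CrysEnergyUpper →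
HasPeriodicGroundStateEnergy lennardJones 3 (conjunct (i)). Proof: the Target's P₀ is a least
element (g·#bad ≥ 0); e(P₀) ≤ E(N)/N for N ≥ 1 by periodising each injective configuration (le_ciInf
over the injective subtype, nonempty_injective_config); limsup ≤ ⨅ ≤ e(P₀) (ciInf_le, range bounded
below by e(P₀)); BlancLewin2015_8_holds supplies the limit e_∞, hence e_∞ = e(P₀) and Tendsto.
[difficulty: provable-now] [BlancLewin2015]
#9 GapGivesWindows (support) — Target → PeriodisationWithWindows → CrysEnergyUpper → WINDOWS, where
WINDOWS (inlined) = ∃ periodic P₀ such that for every sequence of LJ ground states and all R, ε,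
EVENTUALLY IN N some particle i carries a radius-R window ε-matched both ways to x_i + A(P₀.points −
p₀) (p₀ ∈ P₀.motif, A a linear isometry) — exactly the second hypothesis of WindowsCrystallize
(3507). Proof: periodise x^N at radius R + ε (windows agree, so particle i is good iff the motif
point x^N_i of P_N is good); the Target at (R, ε) gives g·#bad_N ≤ N e(P_N) − N e(P₀) ≤ E(N) − N
e(P₀) = o(N) (limit from GapGivesEnergy's argument), so #bad_N < N eventually and a good particle
exists (isometry →ₗᵢ/≃ₗᵢ and site p ∈ points / p₀ ∈ motif conventions are interchangeable: finite
dimension, lattice invariance). [difficulty: provable-now] [BlancLewin2015]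
#9 WindowsCrystallize (support) — shared item stmt-AtomisticToContinuum-3507 of route OneGrainWindow
(same signature, deliberately re-wanted instead of a duplicate): a uniformly separated sequence of
configurations that eventually carries, for every (R, ε), one ε-matched radius-R window of a fixed
periodic P satisfies the convergence clause of IsCrystallizing (diagonal (j, 1/j), τ_j = −x_(i_j),
constant p₀ and A_j → A in O(3) along a subsequence, isometryImage/translate,
PeriodicConfiguration.tendsto_sum_of_eventually_near', m ≡ 1). Separation for LJ ground states is
the proved LennardJonesMinimalDistance_holds. [difficulty: provable-now] [BlancLewin2015,
Literature.MathematicalPhysics.StatisticalMechanics.PeriodicConfiguration.tendsto_sum_of_eventually_near']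
#9 TorusGapGivesCoercivity (support) — BRIDGE to route OneGrainWindow: Target →
PeriodisationWithWindows → LjDefectCoercivity (the body of stmt-3505 verbatim: ∃ P ∀ R₁ θ ∃ κ ∀
finite injective x, N·e(P) + κ·#Bad ≤ 𝓔_LJ(x)). Proof: periodise x at radius R₁ + θ, apply the
Target at (R₁, θ) with the same P₀ and κ := g: g·#Bad(x) = g·#bad(P_x) ≤ N e(P_x) − N e(P₀) ≤ 𝓔(x) −
N e(P₀); N = 0 is trivial. Makes every proof of the Target close 3505 as well (no duplicated prover
effort across the two decompositions). [difficulty: provable-now] [BlancLewin2015, Ruelle1969]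

TWO-LAYER PLAN. Foreseen splits (nothing filed now). (a) DefectGapAtMinimiser ⇐ TwoShellDefectGap →
RobustLocalRules → DefectGapAtMinimiser, where
RobustLocalRules(P₀): ∀ R' ε' ∃ ε L: if every point of P.points ∩ B̄(x, L) is (2, ε)-good w.r.t. P₀
then x is (R', ε')-good (exact
version = local criterion for regular/multiregular systems, DeloneDolbilinShtogrinGaliulin1976 /
DolbilinLagariasSenechal1998; for Barlow-type
P₀ the tree's HalesDSP_layerPackings_holds + "all shells hcp-type ⇒ the Hägg sequence alternates";
robust version by compactness), with the
counting glue #bad(R',ε') ≤ C(L)·#bad(2,ε) (good points are separated). (b) TwoShellDefectGap ⇐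
CoarseGap → FineStackingGap →
TwoShellDefectGap: a coarse certificate pricing every two-shell environment far from ALL
close-packed ones (frustration regime, cards
frustration-range-lp-hierarchy / two-shell-rigidity-certificate) and a fine one among near-Barlow
environments (StackingDefectGap with
relaxed (a, h), mirror-layers line). (c) CrysPeriodicMinAttained as in the sibling routes (0716/0737
+ certified 0670 + compactness).

KILL CRITERIA. Refutation of CrysPeriodicMinAttained (0627; route RefuteCrystalPeriodicMin, 0668)
kills the Target and closes this route
(refuted:CrysPeriodicMinAttained) — together with the conjunct as formalised. ¬LjDefectCoercivity
(3505, OneGrainWindow) refutes the Target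
through the bridge (close or restate together with that route); conversely a proof of the Target
closes 3505. An explicit second non-isometric periodic minimiser or a
gapless periodic family refutes DefectGapAtMinimiser: close THIS route or restate the Target for a
finite list of reference
configurations (the card's CRUX-T(𝓔)); Crystallization itself survives. StackingDefectGap refuted on
the window (certified: domination
false, or fcc ≤ hcp at ideal c/a) forces ranks 2–3 to the relaxed geometry and hands evidence to
RefuteCrystalPeriodicMin. TwoShellDefectGap
refuted while rank 2 stands ⇒ certificates need range > 2 (restate with larger R).
CrystalLocalRigidity (a)+(b) proved elsewhere would
give rank 3 directly (torus sum of e_loc has no boundary term) — then this route's glue closes the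
conjunct first.

NOT DECOMPOSED YET. The certificate for rank 3 (localisation: Voronoi / transfer / LP gauge; range;
averaging radius), robust local rules and the counting
glue of split (a), the frustration/stacking regime split (b), relaxation of (a, h) per stacking in
rank 5, the constants
g(R, ε) ~ min(c ε²/R², |J₂| h/R, −e(P₀)/(c R³)), the finite-list fallback of the Target, the
converse bridge 3505 ⇒ Target (block limits of periodic configurations), and the optional
equivalence "gap on all tori ⇔
approximate gauges" ((D) + Hahn–Banach of the card) — all layer 2, after rank 3, 4 or 5 moves.

CHEAPEST FALSIFIER. (1) Certified interval comparison e(fcc; a, a√(2/3)) vs e(hcp; a, a√(2/3)) for a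
∈ [0.96, 0.98] with r⁻⁶ tail bounds (kit, minutes):
fcc ≤ hcp anywhere on the window kills StackingDefectGap as typed (s = constHagg, p = 1) and sends
ranks 2–3 to relaxed geometry.
(2) Certified sign and domination of J₂(a, a√(2/3)) vs Σ_(k≥3)(k−1)|J_k| on the window (item 0670's
computation restricted to ideal c/a).
(3) For rank 2: a search over periodic competitors with ≤ 4-point motifs near the hcp density for
e(P) − e(hcp) < 1e−6 with P not locally
hcp (near-degeneracy witness). Not run here (one-shot planner session; lit/kit services
intermittently unavailable).

NUMBERS. a* ≈ 0.971 in the tree's normalisation V = r⁻¹²/12 − r⁻⁶/6 (fcc lattice sums L₆ ≈ 14.454,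
L₁₂ ≈ 12.132, a* = (L₁₂/L₆)^(1/6)); hcp below
fcc by ≈ 1e−4 relative (Stillinger2001; L₆(hcp) ≈ 14.455, L₁₂(hcp) ≈ 12.132); J₂ ≈ −7.3e−5 and
|J₂|/Σ_(k≥3) k|J_k| ≈ 250 (route
RefuteCrystalPeriodicMin, uncertified); R = 2 > 2a* ≈ 1.94 covers the hcp shells 12+6+2+18+12+6 =
56; E(N) − N e(P₀) = O(N^(2/3)) expected
(trial blocks) but only o(N) is used by the glue.

DEFINITION REQUESTS. None required: the (R, ε)-matching predicate is inlined in every signature with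
the clause text of 3505/3507 (a Literature definition
`PeriodicConfiguration.WindowMatched`, suggested by OneGrainWindow too, would shorten both route
files; optional). Cite facts possibly wanted later by provers of
rank 5: certified LJ layer couplings (item 0670).

Novelty: Searches (2026-08-15): lit frontier AtomisticToContinuum --since 2020 (30 rows;
crystallization-relevant only arXiv:2407.20762); lit bridges
--cross any (0 relevant); lit search --hybrid "local theorem Delone set regular system local
criterion crystal" (10; Hargittai 1986 pp. 48,
572 → DeloneDolbilinShtogrinGaliulin1976); lit search --source crossref "multiregular point systems"
(doi:10.1007/pl00009397,
doi:10.1007/s00454-021-00292-6, doi:10.1007/s00454-024-00666-6); crossref/zbMATH "energy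
minimization periodic sets" (doi:10.1093/imrn/rnr048,
arXiv:1802.02072, arXiv:1611.07820); OpenAlex and arXiv rate-limited (429), lit galaxy --star all
queued out; plus the card's audited
searches (refuter novelty audit 2026-08-15: Fisher 1964 / Ruelle1969 §3.3–3.4, BlancLewin2015
(8)–(9), HolsztynskiSlawny1978, Radin1987).
Nearest prior art found: IN HUB — route OneGrainWindow (opened 2026-08-15), crux stmt-3505
LjDefectCoercivity = the cluster form of the Target
(equivalent modulo padding/blocks; bridged and its 3507 shared here), and FrustrationRangeLP's
stmt-3424 (coarse periodic coordination gap);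
IN PRINT — CoulangeonSchurmann2011 (doi:10.1093/imrn/rnr048) and CoulangeonSchurmann2021
(arXiv:1802.02072): LOCAL f-optimality of lattices / 2-periodic
sets among m-periodic competitors at fixed density, Gaussian core, via Hessians and spherical
designs — energy only; BlancLewin2015 §1.3
(8)–(9) + Ruelle1969 §3.3–3.4 (energy periodisation / temperedness sign); Theil2006, arXiv:1407.0692
(de  [refs: 10.1007/pl00009397, 10.1007/s00454-021-00292-6, 10.1007/s00454-024-00666-6, 10.1093/imrn/rnr048, 2407.20762, 1802.02072, 1611.07820, 1407.0692, doi:10.1007/pl00009397, doi:10.1007/s00454-021-00292-6, doi:10.1007/s00454-024-00666-6, doi:10.1093/imrn/rnr048, Ruelle1969, BlancLewin2015, HolsztynskiSlawny1978, Radin1987, CoulangeonSchurmann2011, CoulangeonSchurmann2021, Theil2006, DolbilinLagariasSene]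

Barriers (technique_class: flat-torus-reduction, padding-periodisation, defect-gap): - technique_class: flat-torus-reduction, padding-periodisation, defect-gap
- Literature.Barriers.AtomisticToContinuum.IcosahedralClusters: evaded — finite clusters enter only
through PeriodisationWithWindows with the free sign; icosahedral cores of small ground states are
among the o(N) bad particles; nothing is claimed at finite N.
- Literature.Barriers.AtomisticToContinuum.StickySphereClusters: evaded likewise — no finite-N
exactness, no contact counting.
- Literature.Barriers.AtomisticToContinuum.TetrahedralFrustration: applies to PROVING ranks 2–3 (a
per-site one-shell inequality is false: tetrahedra beat octahedra locally); the cruxes are AVERAGED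
inequalities over a closed flat manifold at range ≥ 2 shells, transfers allowed; the bet is that
torus averaging absorbs frustration — unproved.
- Literature.Barriers.AtomisticToContinuum.KissingTwelveDegeneracy: applies — a contact-only gap is
false (every Barlow stacking is kissing-twelve); the cruxes keep the full tail, and the stacking
part of g is isolated as StackingDefectGap with the true couplings.
- Literature.Barriers.AtomisticToContinuum.ShortRangeStackingBlindness: applies — any surrogate of
range < 2h is stacking-blind; R = 2 > √(8/3)a and the energy is the untruncated LJ lattice sum.
- Literature.Barriers.AtomisticToContinuum.FlexibleKissingArrangements: one 12-shell is flexible;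
goodness here is two-shell, two-way matched to a SITE environment, and rigidity is claimed only on
average with an energy price.
- Liter

Novelty grade: variant — route-review grade (refuter b16f6152; lit searchd unavailable, graded on documented searches + own reading): the Target is the TORUS form of OneGrainWindow's LjDefectCoercivity (3505), equivalent modulo padding/block limits as the route itself states; what is new is the decomposition (gap asked of E (refuter refuter-rreview-route-AtomisticToContinu-b16f6152-0, 2026-08-15T13:52:06Z; prior: route-AtomisticToContinuum-OneGrainWindow stmt-AtomisticToContinuum-3505 (cluster form of the same defect-gap coercivity), doi:10.1093/imrn/rnr048 (CoulangeonSchurmann2011), arXiv:1802.02072 (CoulangeonSchurmann2021), Theil2006, arXiv:1504.01153 (BlancLewin2015 §1.3 (8)-(9), Ruelle1969 §3.3-3.4 padding sign), stmt-AtomisticToContinuum-0737 (Peierls count of cubic layer pairs))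

History (route lifecycle, newest last):
- 2026-08-15T13:42:32Z · CLOSED retired — not-a-thesis: assembly does not conclude the sub-problem Statement (operator:999:1257524)

sub-problem: Crystallization · status: closed(retired) · opened planner-plancard-AtomisticToContinuum-Crystal-05106ae8-0 2026-08-15T11:29:13Z · rev 0 · ledger route-AtomisticToContinuum-FlatTorusDefectGap
GENERATED by the gate from the ledger (D-0016/17). Provers cite these decls: `theorem foo : Summit.AtomisticToContinuum.Crystallization.Theses.FlatTorusDefectGap.<Decl> := …` in Summits/AtomisticToContinuum/Crystallization/Theorems/<Name>.lean.
-/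

namespace Summit.AtomisticToContinuum.Crystallization.Theses.FlatTorusDefectGap

open scoped BigOperators Topology Manifold Classical MeasureTheory ProbabilityTheory Matrix InnerProductSpace ComplexConjugate ContinuousMap
open Filter Set Function TopologicalSpace MeasureTheory

attribute [summit_statement] _root_.Crystallization

/-- item stmt-AtomisticToContinuum-4189 · target · rank 0 · closed · moot by None · by planner
why it might fail: exact degeneracy of the periodic minimiser (two non-isometric minimisers ⇒ no single P₀ works; fallback: finite-list variant) or a gapless family of periodic competitors (defect cost per visible defect → 0, e.g. vanishing stacking-fault energy).
sources: BlancLewin2015, arXiv:1504.01153, CoulangeonSchurmann2011, CoulangeonSchurmann2021, Ruelle1969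
[target] X above: ∃ P₀ ∀ R ε ∃ g > 0 ∀ periodic P, g·#bad_(R,ε)(P; P₀) ≤ #motif·(e(P) − e(P₀)),
where x ∈ P.motif is good iff ∃ motif site p₀ of P₀, ∃ linear isometry A (as ≃ₗᵢ) with every p ∈
P₀.points ∩ B̄(p₀,R) having a point of P within ε of x + A(p − p₀) and every y ∈ P.points ∩ B̄(x,R)
lying within ε of some x + A(p − p₀), p ∈ P₀.points (the matching clauses of 3505/3507 verbatim,
with P.points for the particles). Equivalent to ranks 2 ∧ 4 (sketch: X ⇒ 4 and 2 ∧ 4 ⇒ X proved);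
equivalent to OneGrainWindow's 3505 modulo PeriodisationWithWindows (⇒, bridge item) and block
limits (⇐, not filed). -/
@[route_item "route-AtomisticToContinuum-FlatTorusDefectGap"]
def TorusDefectGap : Prop :=
  ∃ P₀ : Literature.MathematicalPhysics.StatisticalMechanics.PeriodicConfiguration 3, ∀ R ε : ℝ, 0 < R → 0 < ε → ∃ g : ℝ, 0 < g ∧ ∀ P : Literature.MathematicalPhysics.StatisticalMechanics.PeriodicConfiguration 3, g * ({x : EuclideanSpace ℝ (Fin 3) | x ∈ P.motif ∧ ¬ (∃ p₀ ∈ P₀.motif, ∃ A : EuclideanSpace ℝ (Fin 3) ≃ₗᵢ[ℝ] EuclideanSpace ℝ (Fin 3), (∀ p ∈ P₀.points, dist p p₀ ≤ R → ∃ y ∈ P.points, dist y (x + A (p - p₀)) ≤ ε) ∧ (∀ y ∈ P.points, dist y x ≤ R → ∃ p ∈ P₀.points, dist y (x + A (p - p₀)) ≤ ε))}.ncard : ℝ) ≤ (P.motif.card : ℝ) * (P.energyPerParticle Literature.MathematicalPhysics.StatisticalMechanics.lennardJones - P₀.energyPerParticle Literature.MathematicalPhysics.StatisticalMechanics.lenn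ardJones)

/-- item stmt-AtomisticToContinuum-4196 · crux · rank 2 · closed · moot by None · by planner
why it might fail: needs a UNIQUE periodic minimiser with no gapless defects: dies if e(hcp)=e(some polytype) exactly, if the stacking-fault energy vanishes (Hägg domination |J₂|>Σk|J_k| false; J₂≈−7e−5 uncertified), or if some defect family has cost per visible defect → 0.
sources: BlancLewin2015, PartayOrtnerCsanyi2017, FlatleyTheil2015, Theil2006, CoulangeonSchurmann2021, Stillinger2001
[crux] GAP AT EVERY MINIMISER (card item T1 in its strongest clean form): every periodic
configuration P₀ attaining the minimum of the Lennard-Jones energy per particle satisfies the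
all-scales uniform defect-gap inequality of the Target (∀ R ε ∃ g ∀ periodic P). Content: uniqueness
of the periodic minimiser up to isometry/local indistinguishability, and strict positivity,
uniformly over ALL periodic competitors of any density and cell size, of the formation energy at
chemical potential e(P₀) per (R,ε)-visible defect — vacancies/interstitials O(1), elastic strain
~ε²/R², stacking faults ~|J₂|h/R, grain boundaries, cluster surfaces (via padding). The hardest and
most informative item; a finite-range certificate proves it through rank 3 + local rules (two-layer
plan). [difficulty: open-problem] -/
@[route_item "route-AtomisticToContinuum-FlatTorusDefectGap"]
def DefectGapAtMinimiser : Prop :=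
  ∀ P₀ : Literature.MathematicalPhysics.StatisticalMechanics.PeriodicConfiguration 3, IsLeast (Set.range fun Q : Literature.MathematicalPhysics.StatisticalMechanics.PeriodicConfiguration 3 => Q.energyPerParticle Literature.MathematicalPhysics.StatisticalMechanics.lennardJones) (P₀.energyPerParticle Literature.MathematicalPhysics.StatisticalMechanics.lennardJones) → ∀ R ε : ℝ, 0 < R → 0 < ε → ∃ g : ℝ, 0 < g ∧ ∀ P : Literature.MathematicalPhysics.StatisticalMechanics.PeriodicConfiguration 3, g * ({x : EuclideanSpace ℝ (Fin 3) | x ∈ P.motif ∧ ¬ (∃ p₀ ∈ P₀.motif, ∃ A : EuclideanSpace ℝ (Fin 3) ≃ₗᵢ[ℝ] EuclideanSpace ℝ (Fin 3), (∀ p ∈ P₀.points, dist p p₀ ≤ R → ∃ y ∈ P.points, dist y (x + A (p - p₀)) ≤ ε) ∧ (∀ y ∈ P.points, dist y x ≤ R → ∃ p ∈ P₀.points, dist y (x + A (p - p₀)) ≤ ε))}.ncard : ℝ) ≤ (P.motif.card : ℝ) * (P.energyPerParticle Literature.MathematicalPhysics.StatisticalMechanics.lennardJones - P₀.energyPerParticle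 Literature.MathematicalPhysics.StatisticalMechanics.lennardJones)

/-- item stmt-AtomisticToContinuum-4197 · crux · rank 3 · closed · moot by None · by planner
why it might fail: as rank 2, plus R=2 may be too short for any certificate: regular tetrahedra/icosahedral shells beat close packing locally (TetrahedralFrustration, IcosahedralClusters), so per-site deficits must be averaged; the stacking part of g(ε) is only ~|J₂|≈1e−4.
sources: Hales2012, HeitmannRadin1980, Theil2006, FlatleyTheil2015, Literature.Barriers.AtomisticToContinuum.TetrahedralFrustration, Literature.Barriers.AtomisticToContinuum.ShortRangeStackingBlindness
[crux] TWO-SHELL CERTIFICATE FORM (the card's CRUX-T with its range fixed, not existential — with '∃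
R' a tiny R would make the item a restatement of attainment): for every periodic minimiser P₀ and
every ε there is g > 0 with g·#bad_(2,ε)(P; P₀) ≤ #motif·(e(P) − e(P₀)) for all periodic P. R = 2
sees the shells at a·(1, √2, √(8/3), √3, √(11/3), 2), a ≈ 0.97, so h- and c-type sites are already
distinguished (ShortRangeStackingBlindness: fcc/hcp differ first at √(8/3)a). Implied by rank 2
(proved in the sketch); conversely rank 2 ⇐ this + robust local rules for P₀ + counting (two-layer
plan). This is what a finite-range transfer certificate / LP gauge proves by summing local deficits
over the torus, where transfers cancel exactly. [difficulty: open-problem] -/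
@[route_item "route-AtomisticToContinuum-FlatTorusDefectGap"]
def TwoShellDefectGap : Prop :=
  ∀ P₀ : Literature.MathematicalPhysics.StatisticalMechanics.PeriodicConfiguration 3, IsLeast (Set.range fun Q : Literature.MathematicalPhysics.StatisticalMechanics.PeriodicConfiguration 3 => Q.energyPerParticle Literature.MathematicalPhysics.StatisticalMechanics.lennardJones) (P₀.energyPerParticle Literature.MathematicalPhysics.StatisticalMechanics.lennardJones) → ∀ ε : ℝ, 0 < ε → ∃ g : ℝ, 0 < g ∧ ∀ P : Literature.MathematicalPhysics.StatisticalMechanics.PeriodicConfiguration 3, g * ({x : EuclideanSpace ℝ (Fin 3) | x ∈ P.motif ∧ ¬ (∃ p₀ ∈ P₀.motif, ∃ A : EuclideanSpace ℝ (Fin 3) ≃ₗᵢ[ℝ] EuclideanSpace ℝ (Fin 3), (∀ p ∈ P₀.points, dist p p₀ ≤ (2 : ℝ) → ∃ y ∈ P.points, dist y (x + A (p - p₀)) ≤ ε) ∧ (∀ y ∈ P.points, dist y x ≤ (2 : ℝ) → ∃ p ∈ P₀.points, dist y (x + A (p - p₀)) ≤ ε))}.ncard : ℝ) ≤ (P.motif.card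 : ℝ) * (P.energyPerParticle Literature.MathematicalPhysics.StatisticalMechanics.lennardJones - P₀.energyPerParticle Literature.MathematicalPhysics.StatisticalMechanics.lennardJones)

/-- item stmt-AtomisticToContinuum-4198 · crux · rank 5 · closed · moot by None · by planner
why it might fail: Hägg domination for the actual LJ layer couplings may fail or hold without margin on [0.96,0.98] (J₂≈−7.3e−5 and the ratio ≈250 are uncertified route-internal numerics); ideal c/a and a common a exclude relaxation, where polytypes compete (Pártay et al.).
sources: PartayOrtnerCsanyi2017, Stillinger2001, BlancLewin2015, Literature.Barriers.AtomisticToContinuum.ShortRangeStackingBlindness, Literature.Barriers.AtomisticToContinuum.KissingTwelveDegeneracy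
[crux] GAPPED STACKING SELECTION FOR THE TRUE LJ COUPLINGS (the Barlow rung of rank 2, typed over
barlowPeriodicConfiguration): there is g > 0 such that for every in-layer spacing a ∈ [24/25, 49/50]
(a window around the LJ-optimal a* ≈ 0.971), ideal layer spacing h = a√(2/3), every period p and
p-periodic Hägg sequence s: p·(e(stacking of s) − e(hcp stacking, same a, h)) ≥ g·#{m < p : s(m+1) =
s(m)} (cubic-type layer pairs per period; 0 for hcp, p for fcc). = the Peierls count of 0737 made
strict + a certified domination J₂(a,h) + Σ_(k≥3)(k−1)|J_k(a,h)| ≤ −g on the window (interval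
arithmetic, r⁻⁶ tail bounds) + the layer regrouping of energyPerParticle (BarlowStackingEnergy:
barlowSiteEnergy_average_eq_haggEnergy, regrouping 'not proved there'). First certifiable evidence
for the gap; its failure kills ranks 2–3 as stated. [difficulty: L] -/
@[route_item "route-AtomisticToContinuum-FlatTorusDefectGap"]
def StackingDefectGap : Prop :=
  ∃ g : ℝ, 0 < g ∧ ∀ (a : ℝ) (ha : a ≠ 0) (hh : a * Real.sqrt (2 / 3) ≠ 0), 24 / 25 ≤ a → a ≤ 49 / 50 → ∀ (p : ℕ) (hp : p ≠ 0) (s : ℤ → ℤ) (hs : ∀ i, s (i + p) = s i), Literature.MathematicalPhysics.StatisticalMechanics.IsHaggSeq s → g * (Nat.card {m : Fin p // s (((m : ℕ) : ℤ) + 1) = s ((m : ℕ) : ℤ)} : ℝ) ≤ (p : ℝ) * ((Literature.MathematicalPhysics.StatisticalMechanics.barlowPeriodicConfiguration s ha hh hp hs).energyPerParticle Literature.MathematicalPhysics.StatisticalMechanics.lennardJones - (Literature.MathematicalPhysics.StatisticalMechanics.barlowPeriodicConfiguration Literature.MathematicalPhysics.StatisticalMechanics.alternatingHagg ha hh (two_ne_zero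 : (2 : ℕ) ≠ 0) Literature.MathematicalPhysics.StatisticalMechanics.alternatingHagg_periodic).energyPerParticle Literature.MathematicalPhysics.StatisticalMechanics.lennardJones)

/-- item stmt-AtomisticToContinuum-3507 · support · rank 9 · closed · moot by None · by planner
sources: BlancLewin2015, Literature.MathematicalPhysics.StatisticalMechanics.PeriodicConfiguration.tendsto_sum_of_eventually_near'
[support] WINDOWS CRYSTALLIZE (the "one grain is enough" bookkeeping; potential-free). If a sequence
x^N of N-point configurations of ℝ³ is uniformly δ-separated and, for every R, ε > 0, eventually in
N some particle carries a radius-R window ε-matched both ways to x_i + A_N(P − p₀) (P a fixed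
periodic configuration, p₀ ∈ motif, A_N a linear isometry), then the convergence clause of
IsCrystallizing holds for x: choose N_j ↑ with (R, ε) = (j, 1/j), τ_j = −x_{i_j}, pass to a
subsequence with constant p₀ (finite motif) and A_{N_j} → A in O(3) fast enough that j·‖A_{N_j} − A‖
→ 0, take P' = isometryImage A (translate (−p₀) P) and m ≡ 1; conclude with
PeriodicConfiguration.tendsto_sum_of_eventually_near' (tree, CrystallizationLocalLimit) — separation
below min(δ, ρ_P)/3 makes the matching a bijection near supp f. [difficulty: provable-now] -/
@[route_item "route-AtomisticToContinuum-FlatTorusDefectGap"]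
def WindowsCrystallize : Prop :=
  ∀ (P : Literature.MathematicalPhysics.StatisticalMechanics.PeriodicConfiguration 3) (x : (N : ℕ) → (Fin N → EuclideanSpace ℝ (Fin 3))), (∃ δ : ℝ, 0 < δ ∧ ∀ (N : ℕ) (i j : Fin N), i ≠ j → δ ≤ dist (x N i) (x N j)) → (∀ R ε : ℝ, 0 < R → 0 < ε → ∀ᶠ N in Filter.atTop, ∃ i : Fin N, ∃ p₀ ∈ P.motif, ∃ A : EuclideanSpace ℝ (Fin 3) ≃ₗᵢ[ℝ] EuclideanSpace ℝ (Fin 3), (∀ p ∈ P.points, dist p p₀ ≤ R → ∃ j : Fin N, dist (x N j) (x N i + A (p - p₀)) ≤ ε) ∧ (∀ j : Fin N, dist (x N j) (x N i) ≤ R → ∃ p ∈ P.points, dist (x N j) (x N i + A (p - p₀)) ≤ ε)) → ∃ (φ : ℕ → ℕ) (τ : ℕ → EuclideanSpace ℝ (Fin 3)) (P' : Literature.MathematicalPhysics.StatisticalMechanics.PeriodicConfiguration 3) (m : EuclideanSpace ℝ (Fin 3) → ℕ), StrictMono φ ∧ (∀ s ∈ P'.points, 1 ≤ m s) ∧ (∀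 g ∈ P'.lattice, ∀ s, m (s + g) = m s) ∧ ∀ f : EuclideanSpace ℝ (Fin 3) → ℝ, Continuous f → HasCompactSupport f → Filter.Tendsto (fun j => ∑ i : Fin (φ j), f (x (φ j) i + τ j)) Filter.atTop (nhds (∑' s : P'.points, (m s : ℝ) * f s))

/-- item stmt-AtomisticToContinuum-4199 · support · rank 9 · closed · moot by None · by planner
sources: BlancLewin2015, Ruelle1969
[support] PADDING-PERIODISATION WITH WINDOWS (transfer (P) of the card; pointwise form of 0715):
every injective N-point configuration x (N ≥ 1) and radius R admit a periodic configuration P with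
motif = range x, N·e(P) ≤ 𝓔_N(x), and P.points ∩ B̄(x_i, R) ⊆ range x for all i. Proof: lattice L·ℤ³
(ZSpan of a scaled basis), L > diam x + R + 1; copies are ≥ 1 apart where V_LJ ≤ 0
(lennardJones_nonpos); the lattice sums are absolutely summable (summable_lennardJones_dist_three),
so N·e(P) = 𝓔_N(x) + (cross terms ≤ 0). [difficulty: provable-now] -/
@[route_item "route-AtomisticToContinuum-FlatTorusDefectGap"]
def PeriodisationWithWindows : Prop :=
  ∀ (N : ℕ) (x : Fin N → EuclideanSpace ℝ (Fin 3)), 0 < N → Function.Injective x → ∀ R : ℝ, ∃ P : Literature.MathematicalPhysics.StatisticalMechanics.PeriodicConfiguration 3, (↑P.motif : Set (EuclideanSpace ℝ (Fin 3))) = Set.range x ∧ (N : ℝ) * P.energyPerParticle Literature.MathematicalPhysics.StatisticalMechanics.lennardJones ≤ Literature.MathematicalPhysics.StatisticalMechanics.interactionEnergy Literature.MathematicalPhysics.StatisticalMechanics.lennardJones x ∧ ∀ i : Fin N, ∀ y ∈ P.points, dist y (x i) ≤ R → y ∈ Set.range x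

-- TODO item stmt-AtomisticToContinuum-4200 · support · rank 9 · closed · moot by None · by planner — BLOCKED: missing decl(s) CrysEnergyUpper; restate via `ledger route edit` once they land:
--   def GapGivesEnergy : Prop := TorusDefectGap → PeriodisationWithWindows → CrysEnergyUpper → Literature.MathematicalPhysics.StatisticalMechanics.HasPeriodicGroundStateEnergy Literature.MathematicalPhysics.StatisticalMechanics.lennardJones 3

-- TODO item stmt-AtomisticToContinuum-4201 · support · rank 9 · closed · moot by None · by planner — BLOCKED: missing decl(s) CrysEnergyUpper; restate via `ledger route edit` once they land:
--   def GapGivesWindows : Prop := TorusDefectGap → PeriodisationWithWindows → CrysEnergyUpper → ∃ P₀ : Literature.MathematicalPhysics.StatisticalMechanics.PeriodicConfiguration 3, ∀ x : (N : ℕ) → (Fin N → EuclideanSpace ℝ (Fin 3)), (∀ N, Literature.MathematicalPhysics.StatisticalMechanics.IsGroundState Literature.MathematicalPhysics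

/-- item stmt-AtomisticToContinuum-4202 · support · rank 9 · closed · moot by None · by planner
sources: BlancLewin2015, Ruelle1969
[support] BRIDGE to route OneGrainWindow: Target → PeriodisationWithWindows → LjDefectCoercivity
(the body of stmt-3505 verbatim: ∃ P ∀ R₁ θ ∃ κ ∀ finite injective x, N·e(P) + κ·#Bad ≤ 𝓔_LJ(x)).
Proof: periodise x at radius R₁ + θ, apply the Target at (R₁, θ) with the same P₀ and κ := g:
g·#Bad(x) = g·#bad(P_x) ≤ N e(P_x) − N e(P₀) ≤ 𝓔(x) − N e(P₀); N = 0 is trivial. Makes every proof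
of the Target close 3505 as well (no duplicated prover effort across the two decompositions).
[difficulty: provable-now] -/
@[route_item "route-AtomisticToContinuum-FlatTorusDefectGap"]
def TorusGapGivesCoercivity : Prop :=
  TorusDefectGap → PeriodisationWithWindows → ∃ P : Literature.MathematicalPhysics.StatisticalMechanics.PeriodicConfiguration 3, ∀ R₁ θ : ℝ, 0 < R₁ → 0 < θ → ∃ κ : ℝ, 0 < κ ∧ ∀ (N : ℕ) (x : Fin N → EuclideanSpace ℝ (Fin 3)), Function.Injective x → let W : ℝ → ℝ → Fin N → EuclideanSpace ℝ (Fin 3) → (EuclideanSpace ℝ (Fin 3) ≃ₗᵢ[ℝ] EuclideanSpace ℝ (Fin 3)) → Prop := fun ρ η i p₀ A => (∀ p ∈ P.points, dist p p₀ ≤ ρ → ∃ j : Fin N, dist (x j) (x i + A (p - p₀)) ≤ η) ∧ (∀ j : Fin N, dist (x j) (x i) ≤ ρ → ∃ p ∈ P.points, dist (x j) (x i + A (p - p₀)) ≤ η); (N : ℝ) * P.energyPerParticle Literature.MathematicalPhysics.StatisticalMechanics.lennardJones + κ * (Nat.card {i : Fin N // ¬ ∃ p₀ ∈ P.motif, ∃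 A : EuclideanSpace ℝ (Fin 3) ≃ₗᵢ[ℝ] EuclideanSpace ℝ (Fin 3), W R₁ θ i p₀ A} : ℝ) ≤ Literature.MathematicalPhysics.StatisticalMechanics.interactionEnergy Literature.MathematicalPhysics.StatisticalMechanics.lennardJones x

-- TODO item stmt-AtomisticToContinuum-4203 · assembly · rank 1 · closed · moot by None · by planner — BLOCKED: missing decl(s) CrysEnergyUpper, CrysPeriodicMinAttained; restate via `ledger route edit` once they land:
--   def Assembly : Prop := DefectGapAtMinimiser → CrysPeriodicMinAttained → PeriodisationWithWindows → CrysEnergyUpper → GapGivesEnergy → GapGivesWindows → WindowsCrystallize → Literature.MathematicalPhysics.StatisticalMechanics.Crystallization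

end Summit.AtomisticToContinuum.Crystallization.Theses.FlatTorusDefectGap
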